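import Summits.AtomisticToContinuum.FouriersLaw.Theorems.EmbeddedDrudeMourreGreenKuboContinuationMnRecurrence
import HarnessLib

/-!
# Three-term recurrence of orthonormal polynomials (general measure)

Helper for the line `FilterInvariance` of the crux `EmbeddedDrudeMourre.GreenKuboContinuation`
(stub `stub_mnRecurrenceB`, wave 2: the general Máté–Nevai theorem). If every polynomial is
`τ`-integrable and `p : ℕ → ℝ[X]` is an orthonormal polynomial sequence of `τ`
(`natDegree (p n) = n`, positive leading coefficients `k_n`, `∫ p_m p_n dτ = δ_{mn}`), then with
`A n = k_n / k_{n+1}` and `B n = ∫ ω p_n(ω)² dτ`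

  `X p_0 = A_0 p_1 + B_0 p_0`, `X p_{n+1} = A_{n+1} p_{n+2} + B_{n+1} p_{n+1} + A_n p_n`

(Szegő, *Orthogonal polynomials*, Thm 3.2.1; Chihara, *An introduction to orthogonal
polynomials*, Ch. I §4). This is the even-measure file `…MnRecurrence` with the diagonal Jacobi
coefficient `B n` kept (there it vanished by evenness); the linear-algebra helpers `mnRec_*`
(Fourier coefficients, `p_N ⊥ degreeLT N`, `deg (X p_n - A_n p_{n+1}) < n + 1`,
`∫ ω p_{n+1} p_n dτ = A_n`) are imported from that file, not restated.

Proof: the difference `X p_{n+1} - A_{n+1} p_{n+2} - B_{n+1} p_{n+1} - A_n p_n` has degree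
`< n + 2` (the leading coefficients of `X p_{n+1}` and `A_{n+1} p_{n+2}` agree,
`mnRec_degree_X_mul_sub_lt`; the two other terms have degree `≤ n + 1`) and is orthogonal to
`p_m` for `m < n + 2`: for `m < n` because `deg (X p_m) = m + 1 < n + 1`
(`mnRec_integral_id_mul_eq_zero`), for `m = n` because `∫ ω p_{n+1} p_n dτ = A_n`
(`mnRec_integral_id_mul_succ`), for `m = n + 1` by the definition of `B_{n+1}`; hence it
vanishes (`mnRec_eq_zero_of_orthogonal`). Likewise `X p_0 - A_0 p_1 - B_0 p_0` has degree `< 1`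
and is orthogonal to `p_0`.
-/

noncomputable section

namespace Summit.AtomisticToContinuum.FouriersLaw.Theorems.GreenKuboContinuation.BandLimitedKrylov

open Filter Topology MeasureTheory Set Polynomial

section OrthonormalPolySeqB

variable {p : ℕ → ℝ[X]}

/-- `deg (a p_k) ≤ k` for a polynomial sequence with `deg p_k = k` (also when `a = 0`). -/
theorem mnRecB_degree_C_mul_le (hpdeg : ∀ n, (p n).natDegree = n)
    (hplc : ∀ n, 0 < (p n).leadingCoeff) (a : ℝ) (k : ℕ) :
    (C a * p k).degree ≤ (k : WithBot ℕ) := by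
  rw [← smul_eq_C_mul]
  exact (degree_smul_le a (p k)).trans (mnRec_degree_eq hpdeg hplc k).le

end OrthonormalPolySeqB

/-- **`stub_mnRecurrenceB` — three-term recurrence of orthonormal polynomials** (Szegő,
*Orthogonal polynomials*, Thm 3.2.1; Van Assche, LNM 1265, (0.2.5); Chihara Ch. I §4). If every
polynomial is `τ`-integrable and `p_n` is an orthonormal polynomial sequence of `τ`
(`deg p_n = n`, `k_n > 0`), then with `A_n = k_n/k_{n+1}` and `B_n = ∫ x p_n(x)² dτ`:
`x p_0 = A_0 p_1 + B_0 p_0` and `x p_{n+1} = A_{n+1} p_{n+2} + B_{n+1} p_{n+1} + A_n p_n`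
(the difference of the two sides has degree `< n + 2` and is orthogonal to `p_0, …, p_{n+1}`,
hence vanishes). -/
theorem stub_mnRecurrenceB :
    ∀ (τ : Measure ℝ) (p : ℕ → ℝ[X]) (A B : ℕ → ℝ),
      (∀ f : ℝ[X], Integrable (fun ω => f.eval ω) τ) →
      (∀ n, (p n).natDegree = n) → (∀ n, 0 < (p n).leadingCoeff) →
      (∀ m n, ∫ ω, (p m).eval ω * (p n).eval ω ∂τ = if m = n then 1 else 0) →
      (∀ n, A n = (p n).leadingCoeff / (p (n + 1)).leadingCoeff) →
      (∀ n, B n = ∫ ω, ω * ((p n).eval ω) ^ 2 ∂τ) →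
      X * p 0 = C (A 0) * p 1 + C (B 0) * p 0 ∧
        ∀ n, X * p (n + 1) = C (A (n + 1)) * p (n + 2) + C (B (n + 1)) * p (n + 1) + C (A n) * p n := by
  intro τ p A B hint hpdeg hplc hporth hA hB
  have hint2 := mnRec_integrable_mul (τ := τ) hint
  have hint3 := mnRec_integrable_id_mul (τ := τ) hint
  -- the diagonal Jacobi coefficient, `∫ ω p_k p_k dτ = B k`
  have hb : ∀ k, ∫ ω, ω * ((p k).eval ω * (p k).eval ω) ∂τ = B k := fun k => by
    rw [hB k]
    simp only [sq]
  refine ⟨?_, fun n => ?_⟩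
  · -- `X p_0 - A_0 p_1 - B_0 p_0` has degree `< 1` and is orthogonal to `p_0`
    have hdeg : (X * p 0 - C (A 0) * p 1 - C (B 0) * p 0).degree < ((1 : ℕ) : WithBot ℕ) := by
      refine (degree_sub_le _ _).trans_lt (max_lt ?_ ?_)
      · exact mnRec_degree_X_mul_sub_lt hpdeg hplc A hA 0
      · exact (mnRecB_degree_C_mul_le hpdeg hplc (B 0) 0).trans_lt
          (by exact_mod_cast Nat.zero_lt_one)
    have hq := mnRec_eq_zero_of_orthogonal hint hpdeg hplc hporth 1
      (X * p 0 - C (A 0) * p 1 - C (B 0) * p 0) hdeg fun m hm => by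
      obtain rfl : m = 0 := by omega
      have e : ∀ ω, (X * p 0 - C (A 0) * p 1 - C (B 0) * p 0).eval ω * (p 0).eval ω =
          ω * ((p 0).eval ω * (p 0).eval ω) - A 0 * ((p 1).eval ω * (p 0).eval ω) -
            B 0 * ((p 0).eval ω * (p 0).eval ω) := fun ω => by
        simp only [eval_sub, eval_mul, eval_X, eval_C]; ring
      have h1 : Integrable (fun ω => ω * ((p 0).eval ω * (p 0).eval ω) -
          A 0 * ((p 1).eval ω * (p 0).eval ω)) τ :=
        (hint3 _ _).sub ((hint2 _ _).const_mul _)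
      simp_rw [e]
      rw [integral_sub h1 ((hint2 _ _).const_mul _),
        integral_sub (hint3 _ _) ((hint2 _ _).const_mul _), integral_const_mul,
        integral_const_mul, hb 0, hporth, hporth, if_neg Nat.one_ne_zero, if_pos rfl]
      ring
    linear_combination hq
  · -- `X p_{n+1} - A_{n+1} p_{n+2} - B_{n+1} p_{n+1} - A_n p_n` has degree `< n + 2` and is
    -- orthogonal to `p_m`, `m < n + 2`
    have hdeg : (X * p (n + 1) - C (A (n + 1)) * p (n + 2) - C (B (n + 1)) * p (n + 1) -
        C (A n) * p n).degree < ((n + 2 : ℕ) : WithBot ℕ) := by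
      refine (degree_sub_le _ _).trans_lt
        (max_lt ((degree_sub_le _ _).trans_lt (max_lt ?_ ?_)) ?_)
      · exact mnRec_degree_X_mul_sub_lt hpdeg hplc A hA (n + 1)
      · exact (mnRecB_degree_C_mul_le hpdeg hplc (B (n + 1)) (n + 1)).trans_lt
          (by exact_mod_cast (by omega : n + 1 < n + 2))
      · exact (mnRecB_degree_C_mul_le hpdeg hplc (A n) n).trans_lt
          (by exact_mod_cast (by omega : n < n + 2))
    have hq := mnRec_eq_zero_of_orthogonal hint hpdeg hplc hporth (n + 2)
      (X * p (n + 1) - C (A (n + 1)) * p (n + 2) - C (B (n + 1)) * p (n + 1) - C (A n) * p n)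
      hdeg fun m hm => by
      have e : ∀ ω, (X * p (n + 1) - C (A (n + 1)) * p (n + 2) - C (B (n + 1)) * p (n + 1) -
          C (A n) * p n).eval ω * (p m).eval ω =
          ω * ((p (n + 1)).eval ω * (p m).eval ω) -
            A (n + 1) * ((p (n + 2)).eval ω * (p m).eval ω) -
            B (n + 1) * ((p (n + 1)).eval ω * (p m).eval ω) -
            A n * ((p n).eval ω * (p m).eval ω) := fun ω => by
        simp only [eval_sub, eval_mul, eval_X, eval_C]; ring
      have h1 : Integrable (fun ω => ω * ((p (n + 1)).eval ω * (p m).eval ω) -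
          A (n + 1) * ((p (n + 2)).eval ω * (p m).eval ω)) τ :=
        (hint3 _ _).sub ((hint2 _ _).const_mul _)
      have h2 : Integrable (fun ω => ω * ((p (n + 1)).eval ω * (p m).eval ω) -
          A (n + 1) * ((p (n + 2)).eval ω * (p m).eval ω) -
          B (n + 1) * ((p (n + 1)).eval ω * (p m).eval ω)) τ :=
        h1.sub ((hint2 _ _).const_mul _)
      simp_rw [e]
      rw [integral_sub h2 ((hint2 _ _).const_mul _), integral_sub h1 ((hint2 _ _).const_mul _),
        integral_sub (hint3 _ _) ((hint2 _ _).const_mul _), integral_const_mul,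
        integral_const_mul, integral_const_mul, hporth, hporth, hporth,
        if_neg (show n + 2 ≠ m by omega)]
      rcases (by omega : m < n ∨ m = n ∨ m = n + 1) with hm' | hm' | rfl
      · rw [mnRec_integral_id_mul_eq_zero hint hpdeg hplc hporth (n + 1) m (by omega),
          if_neg (show n + 1 ≠ m by omega), if_neg (show n ≠ m by omega)]
        ring
      · rw [hm', mnRec_integral_id_mul_succ hint hpdeg hplc hporth A hA n,
          if_neg (show n + 1 ≠ n by omega), if_pos rfl]
        ring
      · rw [hb (n + 1), if_pos rfl, if_neg (show n ≠ n + 1 by omega)]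
        ring
    linear_combination hq

end Summit.AtomisticToContinuum.FouriersLaw.Theorems.GreenKuboContinuation.BandLimitedKrylov

end
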